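import Summits.AtomisticToContinuum.Crystallization.Theorems.ExcessDecayLiouvilleLevelMasses

/-!
# Route `ExcessDecayLiouville`: dyadic decomposition of the weighted far mass (nonlinear half, IX)

Harmonic-replacement architecture for item `ExcessDecay` (stmt-AtomisticToContinuum-9334), nonlinear half.
The weighted far masses `𝐉[f, Y] = Σ'_q ‖f q‖² max(dist q c₀, Y)⁻⁸` of GRADIENT fields must be estimated
through gradient (Caccioppoli) bounds on balls, never through values; the bridge is the elementary dyadic
decomposition (`weight_le_dyadic`, `farMass_le_dyadic`): for a nonnegative `g` supported in
`B_{2^{K+1}Y}(c₀)`,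

`Σ'_q g q · max(dist q c₀, Y)⁻⁸ ≤ Σ_{n ≤ K} (2ⁿY)⁻⁸ Σ'_q g q 𝟙[dist q c₀ ≤ 2^{n+1} Y]`.

All `[folklore]`; helper lemmas, nothing here closes an item.
-/

noncomputable section

namespace Summit.AtomisticToContinuum.Crystallization.Theorems.ExcessDecayLiouville

open scoped BigOperators Topology Classical
open Literature.MathematicalPhysics.StatisticalMechanics
open Summit.AtomisticToContinuum.Crystallization.Theorems.PhononStabilityNegative

/-- **One point**: if `d ≤ 2^{K+1} Y` (`Y > 0`, `d ≥ 0`) then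
`max(d, Y)⁻⁸ ≤ Σ_{n ≤ K} (2ⁿ Y)⁻⁸ 𝟙[d ≤ 2^{n+1} Y]`. [folklore] -/
theorem weight_le_dyadic {Y d : ℝ} (hY : 0 < Y) (hd : 0 ≤ d) :
    ∀ K : ℕ, d ≤ 2 ^ (K + 1) * Y →
      (max d Y)⁻¹ ^ 8 ≤ ∑ n ∈ Finset.range (K + 1), ((2 : ℝ) ^ n * Y)⁻¹ ^ 8 * (if d ≤ 2 ^ (n + 1) * Y then (1 : ℝ) else 0) := by
  intro K
  induction K with
  | zero =>
    intro hK
    rw [zero_add, Finset.sum_range_one, if_pos (by simpa using hK), mul_one, pow_zero, one_mul]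
    exact pow_le_pow_left₀ (by positivity) ((inv_le_inv₀ (lt_max_of_lt_right hY) hY).2 (le_max_right _ _)) 8
  | succ K ih =>
    intro hK
    rw [Finset.sum_range_succ]
    by_cases hdK : d ≤ 2 ^ (K + 1) * Y
    · have h1 := ih hdK
      have h2 : 0 ≤ ((2 : ℝ) ^ (K + 1) * Y)⁻¹ ^ 8 * (if d ≤ 2 ^ (K + 1 + 1) * Y then (1 : ℝ) else 0) := by positivity
      linarith
    · have hdK' : 2 ^ (K + 1) * Y < d := lt_of_not_ge hdK
      have hsum : 0 ≤ ∑ n ∈ Finset.range (K + 1), ((2 : ℝ) ^ n * Y)⁻¹ ^ 8 * (if d ≤ 2 ^ (n + 1) * Y then (1 : ℝ) else 0) :=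
        Finset.sum_nonneg fun n _ => by positivity
      rw [if_pos hK, mul_one]
      have hmax : max d Y = d := max_eq_left (by nlinarith [one_le_pow₀ (one_le_two : (1 : ℝ) ≤ 2) (n := K + 1)])
      rw [hmax]
      have hpow : 0 < (2 : ℝ) ^ (K + 1) * Y := by positivity
      have h3 : d⁻¹ ^ 8 ≤ ((2 : ℝ) ^ (K + 1) * Y)⁻¹ ^ 8 :=
        pow_le_pow_left₀ (by positivity) ((inv_le_inv₀ (by linarith) hpow).2 hdK'.le) 8
      linarith

section

variable {t : Fin 2 → (EuclideanSpace ℝ (Fin 3))} {A : (EuclideanSpace ℝ (Fin 3)) →L[ℝ] (EuclideanSpace ℝ (Fin 3))}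

/-- **Dyadic decomposition of a weighted far mass over the sites** (see the module docstring). [folklore] -/
theorem farMass_le_dyadic (g : (EuclideanSpace ℝ (Fin 3)) → ℝ) (hg0 : ∀ x, 0 ≤ g x)
    (hgfin : (Function.support g).Finite) (c₀ : EuclideanSpace ℝ (Fin 3)) {Y : ℝ} (hY : 0 < Y) (K : ℕ)
    (hK : ∀ x, g x ≠ 0 → dist x c₀ ≤ 2 ^ (K + 1) * Y) :
    ∑' q : Sites₀ t A, g q * (max (dist (q : EuclideanSpace ℝ (Fin 3)) c₀) Y)⁻¹ ^ 8 ≤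
      ∑ n ∈ Finset.range (K + 1), ((2 : ℝ) ^ n * Y)⁻¹ ^ 8 *
        ∑' q : Sites₀ t A, g q * (if dist (q : EuclideanSpace ℝ (Fin 3)) c₀ ≤ 2 ^ (n + 1) * Y then (1 : ℝ) else 0) := by
  -- all families are finitely supported
  have hfin : (Subtype.val ⁻¹' Function.support g : Set (Sites₀ t A)).Finite :=
    hgfin.preimage Subtype.val_injective.injOn
  have hS : ∀ (w : Sites₀ t A → ℝ), Summable (fun q : Sites₀ t A => g q * w q) := by
    intro w
    refine summable_of_ne_finset_zero (s := hfin.toFinset) fun q hq => ?_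
    have : g q = 0 := by
      by_contra h
      exact hq ((Set.Finite.mem_toFinset _).2 h)
    rw [this, zero_mul]
  -- pointwise
  have hpt : ∀ q : Sites₀ t A, g q * (max (dist (q : EuclideanSpace ℝ (Fin 3)) c₀) Y)⁻¹ ^ 8 ≤
      ∑ n ∈ Finset.range (K + 1), ((2 : ℝ) ^ n * Y)⁻¹ ^ 8 *
        (g q * (if dist (q : EuclideanSpace ℝ (Fin 3)) c₀ ≤ 2 ^ (n + 1) * Y then (1 : ℝ) else 0)) := by
    intro q
    by_cases hgq : g q = 0
    · rw [hgq, zero_mul]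
      exact Finset.sum_nonneg fun n _ => by rw [zero_mul, mul_zero]
    · have hw := weight_le_dyadic hY dist_nonneg K (hK q hgq)
      have := mul_le_mul_of_nonneg_left hw (hg0 q)
      rw [Finset.mul_sum] at this
      refine this.trans (le_of_eq (Finset.sum_congr rfl fun n _ => by ring))
  calc _ ≤ ∑' q : Sites₀ t A, ∑ n ∈ Finset.range (K + 1), ((2 : ℝ) ^ n * Y)⁻¹ ^ 8 *
        (g q * (if dist (q : EuclideanSpace ℝ (Fin 3)) c₀ ≤ 2 ^ (n + 1) * Y then (1 : ℝ) else 0)) :=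
        Summable.tsum_le_tsum hpt (hS _) (summable_sum fun n _ => (hS _).mul_left _)
    _ = ∑ n ∈ Finset.range (K + 1), ∑' q : Sites₀ t A, ((2 : ℝ) ^ n * Y)⁻¹ ^ 8 *
        (g q * (if dist (q : EuclideanSpace ℝ (Fin 3)) c₀ ≤ 2 ^ (n + 1) * Y then (1 : ℝ) else 0)) :=
        Summable.tsum_finsetSum fun n _ => (hS _).mul_left _
    _ = _ := Finset.sum_congr rfl fun n _ => tsum_mul_left

end

end Summit.AtomisticToContinuum.Crystallization.Theorems.ExcessDecayLiouville

end
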